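import Summits.BirchSwinnertonDyer.Rank1Residual.F1Sign2.TwistPeriodUnitCanonicalProofs
import HarnessLib

/-!
# Cell `bsd-f1-sign2`, AN-33s / AN-33♭ (§13–§14): the DOOR SUPPLY `hSup` on the egg sub-slice = the canonical bit AN-33p‴ ⊕ named residuals; theorem side on `{4 ∤ N_W}` via the Literature fact hGV♭ — KERNEL-CHECKED assembly + residual `def`s (-an g16, Sketch_v37 §13–§14)

PORT (cell `bsd-f1-sign2`, seat `-ty` g11) of -an g16's tree-rebased file of record `MEMO-an-data/g16/Sketch_v37.lean` 454eaaa5b944aeb6 (= MEMO-an v1.40 /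
`Sketch_v36.lean` 335ae8cb61bfaf5b rebased on the tree: imports `F1Sign2/UnitDoorParityAtTwo` + `F1Sign2/TwistedMinusSymbolSumProofs`, the 37 decls
byte-identical in the tree deleted, the v32-generalised «units AWAY from M» helpers renamed `…_away`; farm rc 0 · 0 err · 0 warn · 0 sorry,
`bc/Sketch_v37_check.json` 6d9656a1424da834; evidence #60 on stmt-23715).  REF1 §126 (refuter-bsd-f1-sign2-ref1 g11, 2026-08-28T17:18:39Z): «§4–§10 Away
generalisation clean; 29/29 new theorems axioms {propext, Classical.choice, Quot.sound}».  Typer edits = this header, the section ranges, added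
docstrings on undocumented helpers; proofs VERBATIM.  Nothing here proves BSD; 23715 not closed.
Sections §13–§14 of the port file: residual `def`s (bookkeeping restrictions of AN-33a `DoorValueSupplyAtTwo` = the lead's `hSup`, REF1 §122 T1
bookkeeping-grade; BC7 `bc/Probe_v36.txt` a45dc774fb4644a6 5/5 CLEAN; not separately audited — binder names for the assembly) I `EggBadAtTwoDoorValueSupply`,
II `NonEggDoorValueSupply`, III `OffEggDoorValueSupply`, IV `EggShaTwoDoorValueSupply` (census-BLIND: all 1 712 ENGINE U inputs have Ш_an = 1), I♭
`EggFourDvdDoorValueSupply`; THEOREMS `hSup_of_egg_goodAtTwo`, `doorValueSupplyAtTwo_of_parts : … → DoorValueSupplyAtTwo` (AN-33a assembled from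
AN-33p‴ + hGV + modularity + residuals), and on `{4 ∤ N_W}` (good OR multiplicative at 2) AN-33x♭ `doorUnitValueAt_of_eggTwiceHalfSumOddLaw_notFourDvd`,
AN-33s♭ `hSup_of_egg_notFourDvd`, `doorValueSupplyAtTwo_of_parts_notFourDvd` with the hypothesis hGV♭ taken BY NAME from the Literature named fact
`Literature.NumberTheory.EllipticCurves.numRealComponents_mul_imaginaryPeriodRat_eq_unit_mul_minusPeriod_two_of_not_four_dvd` (p653706, D-an-87; Česnavičius
2018 Thm 1.2 — the port file's local copy of that def is CUT here).  NET (MEMO-an v1.39/v1.40, ENGINE U head counts on 1 712 slice curves): theorem side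
of hSup (mod hGV♭ + modularity + ONE canonical bit per curve) = Δ>0 ∧ MeetsEgg ∧ Ш[2] = 0 ∧ 4 ∤ N: 394 curves; residual I♭ 122; II (Δ<0) 1 101; III
(Δ>0 off-egg) 95.  REF2 v37 (D-an-88): hGV♭ IN-PRINT ASSEMBLY; AN-33s♭/x♭ VARIANT corollary-of-print propagation (nearest Zhai 2016 Thm 1.2, Kriz–Li
2019 Thm 5.1(2), A–N–S 2026 Thm 1.1/4.1); beyond-print no.  [cite: Cesnavicius2018, Thm. 1.2] [cite: Zhai2016, Thm. 1.2] [cite: KrizLi2019, Thm. 5.1]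
-/

set_option autoImplicit false

noncomputable section

open scoped Classical MatrixGroups ModularForm

open CongruenceSubgroup WeierstrassCurve NumberField Literature.NumberTheory.EllipticCurves Literature.NumberTheory.EllipticCurves.ModularForms
  Literature.NumberTheory.EllipticCurves.Rank1Residual
  Literature.NumberTheory.EllipticCurves.Rank1Residual.Typed
  Summit.BirchSwinnertonDyer.Rank1Residual
  Summit.BirchSwinnertonDyer.Rank1Residual.F1Sign2
  Summit.BirchSwinnertonDyer.Rank1Residual.F1Sign2.TranspositionDoor
  Summit.BirchSwinnertonDyer.BirchSwinnertonDyer.Theorems.RankOneAtTwoOneDoor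

namespace Summit.BirchSwinnertonDyer.Rank1Residual.F1Sign2.ANg16

/-! ### §13 AN-33s (v33): the DOOR SUPPLY on the egg ∧ good-at-`2` sub-slice is a THEOREM; `hSup` = AN-33p‴ ⊕ two residuals

The tree's PROVED Čebotarev supply `GenusKolyTwin.exists_silent_prime_heegnerField` (seat gk2-p5 g7): for `W` globally minimal with
`Δ_W > 0` and `ρ̄_{W,2}` onto, beyond every bound there is a prime `ℓ ≡ 7 (mod 8)`, `ℓ ≡ −1 (mod p)` for every odd `p ∣ N_W`, with
`a_ℓ(W)` odd, `DescAdmissible W (−ℓ)` and `K = ℚ(√−ℓ)` imaginary quadratic of discriminant `−ℓ`.  Such `d = −ℓ` is a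
door-admissible PURE `3`-cycle door (`t = s = 0`), so AN-33x‴ applies: on `{Δ > 0, 2 ∤ N_W}` the conclusion of `hSup` follows from
the canonical bit alone (mod `hGV`, `hasEntireLFunction_rat`, `existsUnique_isNewformOf`).  The rest of `hSup` is recorded as two
typed residual supplies (egg ∧ bad at `2`: mechanism AN-33p; `Δ < 0`: mechanisms AN-33e/h/i), and `DoorValueSupplyAtTwo` is their
conjunction with the theorem (`doorValueSupplyAtTwo_of_parts`, kernel-checked). -/

section Supply

open Summit.BirchSwinnertonDyer.BirchSwinnertonDyer.Theorems

/-- `DescAdmissible ⇒ DoorAdmissible` (drop the `a_q` odd clause). -/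
theorem doorAdmissible_of_descAdmissible (W : WeierstrassCurve ℚ) [W.IsGloballyMinimal] {d : ℤ} (h : DescAdmissible W d) :
    DoorAdmissible W d :=
  ⟨h.1, h.2.1, h.2.2.1, fun q hq hqd => (h.2.2.2.1 q hq hqd).1, h.2.2.2.2⟩

/-- **AN-33s (PROVED): `hSup` on the egg ∧ good-at-`2` sub-slice follows from the canonical bit AN-33p‴** (mod the named facts
`hGV`, `hasEntireLFunction_rat`, `existsUnique_isNewformOf`; the door `d_K = −ℓ` is SUPPLIED by the tree's proved Čebotarev theorem). -/
theorem hSup_of_egg_goodAtTwo (hP : EggTwiceHalfSumOddLawAtTwo)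
    (hGV : numRealComponents_mul_imaginaryPeriodRat_eq_unit_mul_minusPeriod_two) (hE : hasEntireLFunction_rat)
    (hMod : existsUnique_isNewformOf)
    (W : WeierstrassCurve ℚ) [W.IsElliptic] [W.IsGloballyMinimal] [NeZero (W.conductorNorm ℤ)]
    (hCM : ¬ W.HasCM) (hsurj : ∀ n : ℕ, W.HasSurjectiveModNGaloisRep ((2 ^ n : ℕ) : ℤ)) (htor : Odd W.torsionOrder)
    (htam : Odd W.tamagawaProduct) (hrk : W.analyticRank = 1) (hΔ : 0 < W.Δ) (hegg : MeetsEgg W) (hSha : ShaTwoTrivial W) (h2 : W.HasGoodReductionAtPrime 2) :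
    ∃ (K : Type) (_ : Field K) (_ : NumberField K), IsImaginaryQuadratic K ∧ DoorAdmissible W (NumberField.discr K) ∧
      DoorUnitValueAt W (NumberField.discr K) := by
  obtain ⟨g, hgW, -⟩ := hMod W
  have hsurj2 : W.HasSurjectiveModNGaloisRep 2 := by simpa using hsurj 1
  obtain ⟨ℓ, hb, hℓ, hℓ8, hℓN, hsil, hDA, hloc, K, iF, iN, hK, hd, hodd, hd3, hH, h2K, hsq1, hsq2⟩ :=
    GenusKolyTwin.exists_silent_prime_heegnerField W hΔ hsurj2 (W.conductorNorm ℤ)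
  haveI : Fact ℓ.Prime := ⟨hℓ⟩
  have hNw0 : (W.conductorNorm ℤ : ℕ) ≠ 0 := NeZero.ne _
  have hℓNw : ¬ ℓ ∣ W.conductorNorm ℤ := fun h => absurd (Nat.le_of_dvd (Nat.pos_of_ne_zero hNw0) h) (by omega)
  set d : ℤ := -(ℓ : ℤ) with hddef
  have hℓd : (ℓ : ℤ) ∣ d := by rw [hddef]; exact dvd_neg.mpr dvd_rfl
  have hgood : W.HasGoodReductionAtPrime ℓ := (hDA.2.2.2.1 ℓ hℓ hℓd).1 inferInstance
  have haℓ : Odd (W.frobeniusTrace ℓ) := (hDA.2.2.2.1 ℓ hℓ hℓd).2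
  have hDoorAdm : DoorAdmissible W d := doorAdmissible_of_descAdmissible W hDA
  have hd4 : d % 4 = 1 := by have := hDA.2.2.1; omega
  have hgcd : Int.gcd d (W.conductorNorm ℤ) = 1 := by
    rw [Int.gcd_eq_natAbs]
    have h1 : d.natAbs = ℓ := by rw [hddef]; simp
    rw [h1]
    simpa using (Nat.Prime.coprime_iff_not_dvd hℓ).mpr hℓNw
  have hpure : ∀ q ∈ d.natAbs.primeFactors, Odd (W.LFunction q) := by
    intro q hq
    have h1 : d.natAbs = ℓ := by rw [hddef]; simp
    rw [h1, Nat.Prime.primeFactors hℓ, Finset.mem_singleton] at hq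
    subst hq
    rw [LFunction_apply_prime_eq_frobeniusTrace W q hgood]
    exact haℓ
  have hdQ : ((d : ℤ) : ℚ) ≠ 0 := by exact_mod_cast hDA.1.ne
  haveI := W.isElliptic_quadraticTwist hdQ
  obtain ⟨C, hC⟩ := hasGlobalMinimalModel_rat_holds (W.quadraticTwist (d : ℚ))
  haveI := hC
  have hUnit : DoorUnitValueAt W d :=
    doorUnitValueAt_of_eggTwiceHalfSumOddLaw hP hGV hE W hCM hsurj htor htam hrk hΔ hegg hSha h2 g hgW hDA.1 hDA.2.1 hd4 hgcd hpure
      (C • W.quadraticTwist (d : ℚ)) C rfl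
  refine ⟨K, iF, iN, hK, ?_, ?_⟩
  · rw [hd]; exact hDoorAdm
  · rw [hd]; exact hUnit

/-- **Residual supply I (TYPED; conjecture-grade = `hSup` restricted): egg-class (`MeetsEgg`) slice curves with BAD reduction at `2`** have a
door-admissible unit door.  Mechanism on offer: AN-33p (κ-form period index law; a Manin-constant-at-`2∣N` named fact would make it the
canonical bit as in §12).  Why it might fail: as `hSup`. -/
def EggBadAtTwoDoorValueSupply : Prop :=
  ∀ (W : WeierstrassCurve ℚ) [W.IsElliptic] [W.IsGloballyMinimal] [NeZero (W.conductorNorm ℤ)],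
    ¬ W.HasCM → (∀ n : ℕ, W.HasSurjectiveModNGaloisRep ((2 ^ n : ℕ) : ℤ)) → Odd W.torsionOrder → Odd W.tamagawaProduct →
    W.analyticRank = 1 → 0 < W.Δ → MeetsEgg W → ShaTwoTrivial W → ¬ W.HasGoodReductionAtPrime 2 →
    ∃ (K : Type) (_ : Field K) (_ : NumberField K), IsImaginaryQuadratic K ∧ DoorAdmissible W (NumberField.discr K) ∧
      DoorUnitValueAt W (NumberField.discr K)

/-- **Residual supply II (TYPED; conjecture-grade = `hSup` restricted): slice curves with `Δ_W < 0`** (one real component, no egg; single-prime doors are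
transposition doors there, so the unit door has `t ≥ 1` or two `3`-cycle primes) have a door-admissible unit door.  Mechanisms on offer:
AN-33e/h/i.  Why it might fail: as `hSup`. -/
def NonEggDoorValueSupply : Prop :=
  ∀ (W : WeierstrassCurve ℚ) [W.IsElliptic] [W.IsGloballyMinimal] [NeZero (W.conductorNorm ℤ)],
    ¬ W.HasCM → (∀ n : ℕ, W.HasSurjectiveModNGaloisRep ((2 ^ n : ℕ) : ℤ)) → Odd W.torsionOrder → Odd W.tamagawaProduct →
    W.analyticRank = 1 → W.Δ < 0 →
    ∃ (K : Type) (_ : Field K) (_ : NumberField K), IsImaginaryQuadratic K ∧ DoorAdmissible W (NumberField.discr K) ∧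
      DoorUnitValueAt W (NumberField.discr K)

/-- **Residual supply III (TYPED, v34; conjecture-grade = `hSup` restricted): slice curves with `Δ_W > 0` OFF THE EGG** (`¬ MeetsEgg W`: every
rational point lies on the identity real component; 95 of the 611 `Δ > 0` slice curves of ENGINE U, smallest `359a1`, `359b1`, `916d1`, `997a1`;
36 of them with odd conductor) have a door-admissible unit door.  There `η_f = 0` by the census law `η_W = [MeetsEgg W]` (AN-33f; 611/611), so NO
pure-`3`-cycle door is a unit door (census: 198/198 engine-B pure doors of off-egg curves are non-unit; under `BSD` this is `Ш(W^{(d)})[2] ≠ 0`);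
the unit door carries an identity prime (`s ≥ 1`; AN-33i dichotomy, TABLE H′) — ENGINE U finds one for 91 of the 95 within its search bounds.
Why it might fail: as `hSup`. -/
def OffEggDoorValueSupply : Prop :=
  ∀ (W : WeierstrassCurve ℚ) [W.IsElliptic] [W.IsGloballyMinimal] [NeZero (W.conductorNorm ℤ)],
    ¬ W.HasCM → (∀ n : ℕ, W.HasSurjectiveModNGaloisRep ((2 ^ n : ℕ) : ℤ)) → Odd W.torsionOrder → Odd W.tamagawaProduct →
    W.analyticRank = 1 → 0 < W.Δ → ¬ MeetsEgg W →
    ∃ (K : Type) (_ : Field K) (_ : NumberField K), IsImaginaryQuadratic K ∧ DoorAdmissible W (NumberField.discr K) ∧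
      DoorUnitValueAt W (NumberField.discr K)

/-- **Residual supply IV (TYPED, v36; conjecture-grade = `hSup` restricted): egg-class slice curves with `Ш(W)[2] ≠ 0`** (`¬ ShaTwoTrivial W`;
none among ENGINE U's 1 712 inputs, all of which have `Ш_an(W) = 1`).  REF2 r4 (REF2-PLACEMENT-v36 §1.3): for such `W` every admissible door `d`
(`d ≡ 1 (8)`, `(d/p) = 1` at bad `p`, `3`-cycle primes silent) has `dim Sel₂(W^{(d)}) ≥ 2`, so under `BSD₂` NO pure-`3`-cycle door is a unit
door and the canonical bit must vanish — hence `ShaTwoTrivial W` is a NECESSARY hypothesis of AN-33p/p′/p″/p‴ (added in v36, as in the tree's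
AN-33d `EggUnitDoorValueLawAtTwo`), and `hSup` on this class needs doors with `t + 2s ≥ 2`.  Why it might fail: as `hSup` (this is the class where
`hSup` itself is least tested). -/
def EggShaTwoDoorValueSupply : Prop :=
  ∀ (W : WeierstrassCurve ℚ) [W.IsElliptic] [W.IsGloballyMinimal] [NeZero (W.conductorNorm ℤ)],
    ¬ W.HasCM → (∀ n : ℕ, W.HasSurjectiveModNGaloisRep ((2 ^ n : ℕ) : ℤ)) → Odd W.torsionOrder → Odd W.tamagawaProduct →
    W.analyticRank = 1 → 0 < W.Δ → MeetsEgg W → ¬ ShaTwoTrivial W →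
    ∃ (K : Type) (_ : Field K) (_ : NumberField K), IsImaginaryQuadratic K ∧ DoorAdmissible W (NumberField.discr K) ∧
      DoorUnitValueAt W (NumberField.discr K)

/-- **AN-33s′ (PROVED glue, v34/v36): `hSup` = (AN-33p‴ on egg-class ∧ `Ш[2] = 0` ∧ good at 2, a THEOREM mod named facts) ⊕ residual I
(egg-class, bad at 2) ⊕ residual II (`Δ < 0`) ⊕ residual III (`Δ > 0`, off the egg) ⊕ residual IV (egg-class, `Ш[2] ≠ 0`).** -/
theorem doorValueSupplyAtTwo_of_parts (hP : EggTwiceHalfSumOddLawAtTwo)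
    (hGV : numRealComponents_mul_imaginaryPeriodRat_eq_unit_mul_minusPeriod_two) (hE : hasEntireLFunction_rat)
    (hMod : existsUnique_isNewformOf) (hB : EggBadAtTwoDoorValueSupply) (hN : NonEggDoorValueSupply)
    (hO : OffEggDoorValueSupply) (hS : EggShaTwoDoorValueSupply) :
    DoorValueSupplyAtTwo := by
  rw [doorValueSupplyAtTwo_iff]
  intro W _ _ _ hCM hsurj htor htam hrk
  rcases lt_trichotomy W.Δ 0 with hneg | h0 | hpos
  · exact hN W hCM hsurj htor htam hrk hneg
  · exact absurd h0 W.isUnit_Δ.ne_zero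
  · by_cases hegg : MeetsEgg W
    · by_cases hSha : ShaTwoTrivial W
      · by_cases h2 : W.HasGoodReductionAtPrime 2
        · exact hSup_of_egg_goodAtTwo hP hGV hE hMod W hCM hsurj htor htam hrk hpos hegg hSha h2
        · exact hB W hCM hsurj htor htam hrk hpos hegg hSha h2
      · exact hS W hCM hsurj htor htam hrk hpos hegg hSha
    · exact hO W hCM hsurj htor htam hrk hpos hegg

end Supply


/-! ### §14 AN-33t♭/x♭/s♭ (v35): the same chain on `{4 ∤ N_W}` (good OR multiplicative reduction at `2`) from a Manin-constant-at-`2 ∥ N` named fact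

`hGV` (`numRealComponents_mul_imaginaryPeriodRat_eq_unit_mul_minusPeriod_two`, tree, cite GV 2000 Rem. 3.4 + Abbes–Ullmo 1996 Thm A +
Edixhoven 1991 Prop. 2) is stated for GOOD reduction at `2` because its step (2) `2 ∤ c₀` is Abbes–Ullmo (`p ∣ c₀ ⇒ p ∣ N`).  Česnavičius 2018
(Compositio 154, Thm. 1.2; [corpus:paper:arxiv-1703.02951 p.3 L19–25]: «for a new elliptic optimal quotient `π : J_H ↠ E`, `Γ₁(n) ⊂ H ⊂ Γ₀(n)`,
and a prime `p` with `p² ∤ n`: `v_p(c_π) = 0`») supplies step (2) whenever `4 ∤ N` — so the identical three-step chain (Edixhoven: `Λ(ω_{E₀}) =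
c₀Λ_f` for the optimal `E₀`; `2 ∤ c₀`; odd isogeny degree `E₀ → W` since `E[2]` is irreducible) gives the same conclusion on `{4 ∤ N_W, ρ̄₂
irreducible}` (earlier partial result: Agashe–Ribet–Stein 2006 Thm. 2.7 `p ∣ c ⇒ p² ∣ N ∨ p ∣ m_E` [corpus:paper:url-4bb5f7f79b64 p.3 L33, p.4
L2–3]).  §10–§13 are generalised IN PLACE (v35) to a per-curve period datum `hw : ∃ w, ‖w‖₂ = 1 ∧ c_∞(W)·|Ω⁻(W)| = w·Ω⁻_f`
(`…_of_periodUnit`; the `_goodAtTwo` statements are kept verbatim as one-line corollaries), and this section instantiates the datum from the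
`4 ∤ N` fact: AN-33x♭ `doorUnitValueAt_of_eggTwiceHalfSumOddLaw_notFourDvd`, AN-33s♭ `hSup_of_egg_notFourDvd`, residual I♭
`EggFourDvdDoorValueSupply` (egg-class slice curves with `4 ∣ N_W`: 122 of the 325 even-conductor egg-class curves of ENGINE U; the 203 with
`2 ∥ N` move to the theorem side), AN-33s′♭ `doorValueSupplyAtTwo_of_parts_notFourDvd`. -/

section NotFourDvd

open Summit.BirchSwinnertonDyer.BirchSwinnertonDyer.Theorems

variable {N : ℕ} [NeZero N] {f : CuspForm (Gamma0 N) 2}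

/-- -an g16 helper (Sketch_v37, proofs port; kernel-checked). -/
theorem doorUnitValueAt_of_eggTwiceHalfSumOddLaw_notFourDvd (hP : EggTwiceHalfSumOddLawAtTwo)
    (hGV' : numRealComponents_mul_imaginaryPeriodRat_eq_unit_mul_minusPeriod_two_of_not_four_dvd) (hE : hasEntireLFunction_rat)
    (W : WeierstrassCurve ℚ) [W.IsElliptic] [W.IsGloballyMinimal] [NeZero (W.conductorNorm ℤ)]
    (hCM : ¬ W.HasCM) (hsurj : ∀ n : ℕ, W.HasSurjectiveModNGaloisRep ((2 ^ n : ℕ) : ℤ)) (htor : Odd W.torsionOrder)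
    (htam : Odd W.tamagawaProduct) (hrk : W.analyticRank = 1) (hΔ : 0 < W.Δ) (hegg : MeetsEgg W) (hSha : ShaTwoTrivial W) (h4 : ¬ 4 ∣ W.conductorNorm ℤ)
    (g : CuspForm (Gamma0 (W.conductorNorm ℤ)) 2) (hgW : IsNewformOf W g)
    {d : ℤ} (hd0 : d < 0) (hsq : Squarefree d) (hd4 : d % 4 = 1) (hgcd : Int.gcd d (W.conductorNorm ℤ) = 1)
    (hpure : ∀ q ∈ d.natAbs.primeFactors, Odd (W.LFunction q))
    (Wd : WeierstrassCurve ℚ) [Wd.IsElliptic] [Wd.IsGloballyMinimal] (C : VariableChange ℚ) (hC : C • W.quadraticTwist (d : ℚ) = Wd) :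
    DoorUnitValueAt W d := by
  obtain ⟨q₀, a₀, z₀, hq₀, hq₀o, hq₀N, ha₀, ha₀o, hz₀⟩ := hP W hCM hsurj htor htam hrk hΔ hegg hSha (W.conductorNorm ℤ) g hgW
  haveI : NeZero ((2 : ℕ) : ℚ) := ⟨by norm_num⟩
  have hirr : W.HasIrreducibleModPGaloisRep 2 :=
    hasIrreducibleModPGaloisRep_of_hasSurjectiveModNGaloisRep W 2 (by simpa using hsurj 1)
  have hpr : ∀ q ∈ d.natAbs.primeFactors, ¬ q ∣ W.conductorNorm ℤ ∧ cuspCoeff g q = ((W.LFunction q : ℤ) : ℂ) := by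
    intro q hq
    have hqp : q.Prime := Nat.prime_of_mem_primeFactors hq
    have hqd : q ∣ d.natAbs := Nat.dvd_of_mem_primeFactors hq
    refine ⟨fun hqN => ?_, hgW.2 q⟩
    have h1 : q ∣ Int.gcd d (W.conductorNorm ℤ) := by
      rw [Int.gcd_eq_natAbs]
      exact Nat.dvd_gcd hqd (by simpa using hqN)
    rw [hgcd] at h1
    exact hqp.one_lt.ne' (Nat.dvd_one.mp h1)
  exact doorUnitValueAt_of_pureCycle_canonical_of_periodUnit hE W hgW (hGV' W h4 hirr g hgW) hq₀ hq₀o hq₀N ha₀ ha₀o ⟨z₀, hz₀⟩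
    (fun q => W.LFunction q) hd0 hsq hd4 hgcd hpr hpure Wd C hC

/-- -an g16 helper (Sketch_v37, proofs port; kernel-checked). -/
theorem hSup_of_egg_notFourDvd (hP : EggTwiceHalfSumOddLawAtTwo)
    (hGV' : numRealComponents_mul_imaginaryPeriodRat_eq_unit_mul_minusPeriod_two_of_not_four_dvd) (hE : hasEntireLFunction_rat)
    (hMod : existsUnique_isNewformOf)
    (W : WeierstrassCurve ℚ) [W.IsElliptic] [W.IsGloballyMinimal] [NeZero (W.conductorNorm ℤ)]
    (hCM : ¬ W.HasCM) (hsurj : ∀ n : ℕ, W.HasSurjectiveModNGaloisRep ((2 ^ n : ℕ) : ℤ)) (htor : Odd W.torsionOrder)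
    (htam : Odd W.tamagawaProduct) (hrk : W.analyticRank = 1) (hΔ : 0 < W.Δ) (hegg : MeetsEgg W) (hSha : ShaTwoTrivial W) (h4 : ¬ 4 ∣ W.conductorNorm ℤ) :
    ∃ (K : Type) (_ : Field K) (_ : NumberField K), IsImaginaryQuadratic K ∧ DoorAdmissible W (NumberField.discr K) ∧
      DoorUnitValueAt W (NumberField.discr K) := by
  obtain ⟨g, hgW, -⟩ := hMod W
  have hsurj2 : W.HasSurjectiveModNGaloisRep 2 := by simpa using hsurj 1
  obtain ⟨ℓ, hb, hℓ, hℓ8, hℓN, hsil, hDA, hloc, K, iF, iN, hK, hd, hodd, hd3, hH, h2K, hsq1, hsq2⟩ :=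
    GenusKolyTwin.exists_silent_prime_heegnerField W hΔ hsurj2 (W.conductorNorm ℤ)
  haveI : Fact ℓ.Prime := ⟨hℓ⟩
  have hNw0 : (W.conductorNorm ℤ : ℕ) ≠ 0 := NeZero.ne _
  have hℓNw : ¬ ℓ ∣ W.conductorNorm ℤ := fun h => absurd (Nat.le_of_dvd (Nat.pos_of_ne_zero hNw0) h) (by omega)
  set d : ℤ := -(ℓ : ℤ) with hddef
  have hℓd : (ℓ : ℤ) ∣ d := by rw [hddef]; exact dvd_neg.mpr dvd_rfl
  have hgood : W.HasGoodReductionAtPrime ℓ := (hDA.2.2.2.1 ℓ hℓ hℓd).1 inferInstance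
  have haℓ : Odd (W.frobeniusTrace ℓ) := (hDA.2.2.2.1 ℓ hℓ hℓd).2
  have hDoorAdm : DoorAdmissible W d := doorAdmissible_of_descAdmissible W hDA
  have hd4 : d % 4 = 1 := by have := hDA.2.2.1; omega
  have hgcd : Int.gcd d (W.conductorNorm ℤ) = 1 := by
    rw [Int.gcd_eq_natAbs]
    have h1 : d.natAbs = ℓ := by rw [hddef]; simp
    rw [h1]
    simpa using (Nat.Prime.coprime_iff_not_dvd hℓ).mpr hℓNw
  have hpure : ∀ q ∈ d.natAbs.primeFactors, Odd (W.LFunction q) := by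
    intro q hq
    have h1 : d.natAbs = ℓ := by rw [hddef]; simp
    rw [h1, Nat.Prime.primeFactors hℓ, Finset.mem_singleton] at hq
    subst hq
    rw [LFunction_apply_prime_eq_frobeniusTrace W q hgood]
    exact haℓ
  have hdQ : ((d : ℤ) : ℚ) ≠ 0 := by exact_mod_cast hDA.1.ne
  haveI := W.isElliptic_quadraticTwist hdQ
  obtain ⟨C, hC⟩ := hasGlobalMinimalModel_rat_holds (W.quadraticTwist (d : ℚ))
  haveI := hC
  have hUnit : DoorUnitValueAt W d :=
    doorUnitValueAt_of_eggTwiceHalfSumOddLaw_notFourDvd hP hGV' hE W hCM hsurj htor htam hrk hΔ hegg hSha h4 g hgW hDA.1 hDA.2.1 hd4 hgcd hpure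
      (C • W.quadraticTwist (d : ℚ)) C rfl
  refine ⟨K, iF, iN, hK, ?_, ?_⟩
  · rw [hd]; exact hDoorAdm
  · rw [hd]; exact hUnit

/-- **Residual supply I♭ (TYPED, v35; conjecture-grade = `hSup` restricted): egg-class (`MeetsEgg`) slice curves with `4 ∣ N_W`** (additive
reduction at `2`; 122 of ENGINE U's 325 even-conductor egg-class curves: `v₂(N) = 2`: 66, `≥ 3`: 56) have a door-admissible unit door.
Mechanism on offer: AN-33p (κ-form).  Why it might fail: as `hSup`. -/
def EggFourDvdDoorValueSupply : Prop :=
  ∀ (W : WeierstrassCurve ℚ) [W.IsElliptic] [W.IsGloballyMinimal] [NeZero (W.conductorNorm ℤ)],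
    ¬ W.HasCM → (∀ n : ℕ, W.HasSurjectiveModNGaloisRep ((2 ^ n : ℕ) : ℤ)) → Odd W.torsionOrder → Odd W.tamagawaProduct →
    W.analyticRank = 1 → 0 < W.Δ → MeetsEgg W → ShaTwoTrivial W → 4 ∣ W.conductorNorm ℤ →
    ∃ (K : Type) (_ : Field K) (_ : NumberField K), IsImaginaryQuadratic K ∧ DoorAdmissible W (NumberField.discr K) ∧
      DoorUnitValueAt W (NumberField.discr K)

/-- **AN-33s′♭ (PROVED glue, v35): `hSup` = (AN-33p‴ on egg-class ∧ `4 ∤ N`, a THEOREM mod the `4 ∤ N` named-fact candidate + modularity)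
⊕ residual I♭ (egg-class, `4 ∣ N`) ⊕ residual II (`Δ < 0`) ⊕ residual III (`Δ > 0`, off the egg).** -/
theorem doorValueSupplyAtTwo_of_parts_notFourDvd (hP : EggTwiceHalfSumOddLawAtTwo)
    (hGV' : numRealComponents_mul_imaginaryPeriodRat_eq_unit_mul_minusPeriod_two_of_not_four_dvd) (hE : hasEntireLFunction_rat)
    (hMod : existsUnique_isNewformOf) (hB : EggFourDvdDoorValueSupply) (hN : NonEggDoorValueSupply)
    (hO : OffEggDoorValueSupply) (hS : EggShaTwoDoorValueSupply) :
    DoorValueSupplyAtTwo := by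
  rw [doorValueSupplyAtTwo_iff]
  intro W _ _ _ hCM hsurj htor htam hrk
  rcases lt_trichotomy W.Δ 0 with hneg | h0 | hpos
  · exact hN W hCM hsurj htor htam hrk hneg
  · exact absurd h0 W.isUnit_Δ.ne_zero
  · by_cases hegg : MeetsEgg W
    · by_cases hSha : ShaTwoTrivial W
      · by_cases h4 : 4 ∣ W.conductorNorm ℤ
        · exact hB W hCM hsurj htor htam hrk hpos hegg hSha h4
        · exact hSup_of_egg_notFourDvd hP hGV' hE hMod W hCM hsurj htor htam hrk hpos hegg hSha h4
      · exact hS W hCM hsurj htor htam hrk hpos hegg hSha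
    · exact hO W hCM hsurj htor htam hrk hpos hegg

end NotFourDvd

end Summit.BirchSwinnertonDyer.Rank1Residual.F1Sign2.ANg16
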